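import Mathlib

/-!
# SoloBlind — the polynomial-conjugation tower and the type-(3,1) support lemma (anchor of LieExponent §3.32, Prop. 18.5)

Setting (pen side, `paper/LieExponent.md` §3.32, Remark 18.3 – Proposition 18.5): `p₀` regular diagonal, `e` an
ISOSPECTRAL DIRECTION (`p₀ + s e` conjugate to `p₀` for every `s`; equivalently `(p₀, e)` is a Motzkin–Taussky
property-L pair with zero second spectrum).  Checked here:

* `soloLie_tower_intertwine` — the TOWER (Prop. 18.5(a), direction ⇐): if `[a, p] = e`, `[b, p] = e a`,
  `[c, p] = e b` and `e c = 0`, then `g(s) = 1 + s a + s² b + s³ c` intertwines: `g(s) p = (p + s e) g(s)` for every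
  scalar `s` (so `p + s e` is conjugate to `p` whenever `g(s)` is invertible); `soloLie_tower_intertwine₂` is the
  degree-2 case `c = 0`, `e b = 0` (the stratum containing the component `Z` of 18.5);
* `soloLie_bracket_diagonal_entry`, `soloLie_plane_coefficient`, `soloLie_bracket_trace_coefficient` — the algebra of
  the normaliser trichotomy (18.5(c)): a bracket with a diagonal matrix has zero diagonal, so `[y, p₀] = α p₀ + κ e`
  with `e` off-diagonal forces `α = 0` as soon as `p₀` has a non-zero eigenvalue; and `[y, e] = λ p₀ + μ e` with
  `tr e = 0`, `tr p₀ ≠ 0` forces `λ = 0` (in a domain);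
* `soloLie_type31_support` — the support lemma behind 18.5(d), type (3,1): for `y = e_a αᵀ + c · f e_bᵀ` and
  `p` diagonal, `[y, p]` is supported in (row `a`) ∪ (column `b`);
* `soloLie_rowcol_acyclic` — such a support (with `a ≠ b`, no loops) is ACYCLIC: the potential `a ↦ 0`, `b ↦ 2`,
  others `↦ 1` increases strictly along every arc, so `[y, p]` lies in the nilradical `𝔫_w` of a Borel containing
  the torus.
-/

set_option linter.dupNamespace false

namespace Summit.MatrixMultiplication.MatrixMultiplication.Theorems

section Tower

variable {R A : Type*} [CommRing R] [Ring A] [Algebra R A]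

/-- THE TOWER INTERTWINES (Prop. 18.5(a)).  `[a,p] = e`, `[b,p] = e a`, `[c,p] = e b`, `e c = 0` give
`(1 + s a + s² b + s³ c) p = (p + s e)(1 + s a + s² b + s³ c)` for every scalar `s`. -/
theorem soloLie_tower_intertwine (p e a b c : A) (s : R)
    (ha : a * p - p * a = e) (hb : b * p - p * b = e * a) (hc : c * p - p * c = e * b) (he : e * c = 0) :
    (1 + s • a + (s * s) • b + (s * s * s) • c) * p
      = (p + s • e) * (1 + s • a + (s * s) • b + (s * s * s) • c) := by
  have ha' : a * p = e + p * a := by rw [← ha]; abel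
  have hb' : b * p = e * a + p * b := by rw [← hb]; abel
  have hc' : c * p = e * b + p * c := by rw [← hc]; abel
  simp only [add_mul, mul_add, one_mul, mul_one, smul_mul_assoc, mul_smul_comm, smul_smul, ha', hb', hc', he,
    smul_add, smul_zero, add_zero]
  module

/-- Degree-2 case (`c = 0`): `[a,p] = e`, `[b,p] = e a`, `e b = 0` give `(1 + s a + s² b) p = (p + s e)(1 + s a + s² b)`. -/
theorem soloLie_tower_intertwine₂ (p e a b : A) (s : R)
    (ha : a * p - p * a = e) (hb : b * p - p * b = e * a) (he : e * b = 0) :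
    (1 + s • a + (s * s) • b) * p = (p + s • e) * (1 + s • a + (s * s) • b) := by
  have h := soloLie_tower_intertwine p e a b 0 s ha hb (by simp [he]) (by simp)
  simpa using h

end Tower

section Trichotomy

variable {R : Type*} [CommRing R] {n : Type*} [Fintype n] [DecidableEq n]

/-- A bracket with a diagonal matrix has zero diagonal. -/
theorem soloLie_bracket_diagonal_entry (y : Matrix n n R) (d : n → R) (i : n) :
    (y * Matrix.diagonal d - Matrix.diagonal d * y) i i = 0 := by
  simp [Matrix.mul_diagonal, Matrix.diagonal_mul, mul_comm]

/-- 18.5(c), first coefficient: if `[y, p₀] = α p₀ + κ e` with `p₀ = diagonal d`, `e` off-diagonal (`e i i = 0`)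
and `d i` a non-zero-divisor-free witness (`d i ≠ 0` in a domain), then `α = 0`. -/
theorem soloLie_plane_coefficient [IsDomain R] (y e : Matrix n n R) (d : n → R) (α κ : R) (i : n)
    (hdiag : e i i = 0) (hdi : d i ≠ 0)
    (h : y * Matrix.diagonal d - Matrix.diagonal d * y = α • Matrix.diagonal d + κ • e) : α = 0 := by
  have h1 := congrFun (congrFun h i) i
  rw [soloLie_bracket_diagonal_entry] at h1
  simp [hdiag] at h1
  rcases h1 with h1 | h1
  · exact h1
  · exact absurd h1 hdi

omit [DecidableEq n] in
/-- 18.5(c), second coefficient: if `y e - e y = λ p₀ + μ e` with `tr e = 0` and `tr p₀ ≠ 0` then `λ = 0`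
(the trace of a commutator vanishes). -/
theorem soloLie_bracket_trace_coefficient [IsDomain R] (y e p : Matrix n n R) (lam μ : R)
    (htr : Matrix.trace e = 0) (hp : Matrix.trace p ≠ 0)
    (h : y * e - e * y = lam • p + μ • e) : lam = 0 := by
  have h1 := congrArg Matrix.trace h
  rw [Matrix.trace_sub, Matrix.trace_mul_comm, sub_self, Matrix.trace_add, Matrix.trace_smul,
    Matrix.trace_smul, htr, smul_zero, add_zero, smul_eq_mul] at h1
  rcases mul_eq_zero.1 h1.symm with h2 | h2
  · exact h2
  · exact absurd h2 hp

end Trichotomy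

section Support

variable {R : Type*} [CommRing R] {n : Type*} [Fintype n] [DecidableEq n]

/-- TYPE (3,1) SUPPORT LEMMA (18.5(d)).  For `y = e_a αᵀ + c · f e_bᵀ` (the shape forced on a nilpotent `y` of
Jordan type (3,1) with `(ad y)² p₀ = 0`, `p₀` regular diagonal: `Im y² = R e_a`, `ker y² ⊇` the other
coordinate lines) and `p = diagonal d`, every entry of `[y, p]` off row `a` and off column `b` vanishes. -/
theorem soloLie_type31_support (a b : n) (α f : n → R) (c : R) (d : n → R) (i j : n)
    (hi : i ≠ a) (hj : j ≠ b) :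
    let y : Matrix n n R := Matrix.vecMulVec (Pi.single a 1) α + c • Matrix.vecMulVec f (Pi.single b 1)
    (y * Matrix.diagonal d - Matrix.diagonal d * y) i j = 0 := by
  intro y
  have hy : y i j = 0 := by
    simp [y, Matrix.vecMulVec_apply, hi, hj]
  simp [Matrix.mul_diagonal, Matrix.diagonal_mul, hy]

omit [Fintype n] in
/-- ROW–COLUMN SUPPORTS ARE ACYCLIC.  If `a ≠ b` and every arc `(i, j)` of an irreflexive relation lies in row `a`
or column `b` (`i = a ∨ j = b`), then the potential `r` with `r a = 0`, `r b = 2`, `r _ = 1` increases strictly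
along every arc; in particular the relation has no cycle, and a matrix with such a support lies in the
nilradical of the Borel subalgebra defined by any total order refining `r`. -/
theorem soloLie_rowcol_acyclic (a b : n) (hab : a ≠ b) (arc : n → n → Prop)
    (hirr : ∀ i, ¬ arc i i) (hsupp : ∀ i j, arc i j → i = a ∨ j = b) :
    ∃ r : n → ℕ, ∀ i j, arc i j → r i < r j := by
  refine ⟨fun k => if k = a then 0 else if k = b then 2 else 1, ?_⟩
  intro i j hij
  have hij' : i ≠ j := by
    rintro rfl
    exact hirr i hij
  rcases hsupp i j hij with hia | hjb
  · -- arc out of row a: r i = 0 < r j since j ≠ a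
    subst hia
    have hja : j ≠ i := fun h => hij' h.symm
    have hbi : b ≠ i := fun h => hab h.symm
    by_cases hjb : j = b
    · simp [hjb, hbi]
    · simp [hja, hjb]
  · -- arc into column b: r i ≤ 1 < 2 = r j since i ≠ b and b ≠ a
    subst hjb
    have hja : j ≠ a := fun h => hab h.symm
    by_cases hia : i = a
    · simp [hia, hja]
    · have hib : i ≠ j := hij'
      simp [hia, hja, hib]

end Support

end Summit.MatrixMultiplication.MatrixMultiplication.Theorems
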